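import Mathlib.RingTheory.Localization.Defs
import Mathlib.RingTheory.Localization.Away.Basic
import Mathlib.RingTheory.Coprime.Basic
import Literature.Algebra.EuclideanDomain.EuclideanOrderTypeProduct
import HarnessLib

/-!
# Rings of fractions of Euclidean rings are Euclidean, and `e(S⁻¹A) ≤ e(A)`
# (Samuel 1971, Prop. 7; Clark 2015, Thm. 18)

Topic `Literature/Algebra/EuclideanDomain`, namespace `Literature.Algebra.EuclideanDomain` (statements about a
localization `B` of `A` at a submonoid `M` under `….IsLocalization`, the example `ℤ[1/2]` under `….IntAwayTwo`).
THEOREMS ONLY (no `def`, no instance, no named fact), all proved, in the vocabulary of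
`TransfiniteSmallestAlgorithm.lean` (Samuel's stages `samuelSet R α = A_α`, smallest algorithm `samuelRank = θ`, an
*algorithm* `φ : R → W` is `∀ a b, b ≠ 0 → ∃ q r, a = b * q + r ∧ φ r < φ b`) and of
`EuclideanOrderTypeIndecomposable.lean` (the Euclidean order type `e(R) = ⨆ z, ((θ z − 1) + 1)`).

## Sources (read at the page)

* P. Samuel, *About Euclidean rings*, J. Algebra **19** (1971) 282–301 [Samuel1971] (materialised
  `paper:doi-10-1016-0021-8693-71-90110-4`), §3, p. 287, VERBATIM: «PROPOSITION 7. Let `A` be a Euclidean domain, and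
  `S ⊂ A` a multiplicatively closed set (such that `0 ∉ S`).  Then `S⁻¹A` is Euclidean.»  Proof (p. 287): «Let `φ` be
  an algorithm on `A` such that `y ∈ Ax`, `y ≠ 0` implies `φ(x) ≤ φ(y)` (Sec. 2, Prop. 4).  By saturating `S`, we may
  assume it is generated by some prime elements of `A` and by the units.  Then every element `x` of `S⁻¹A` can be
  written as `x = (s/t)·x′` with `s, t ∈ S` and `x′ ∈ A` prime to all elements of `S`; then `x′` is uniquely determined
  up to units by `x`.  We set `φ′(x) = φ(x′)` and show that `φ′` is an algorithm on `S⁻¹A`. … Consider `a, b ∈ S⁻¹A`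
  with `b ≠ 0`, and write `b = (s/t) b′` as above. … there exists `a′ ∈ A` such that … `a ≡ (s/t) a′ (mod S⁻¹Ab)`.  We
  can write `a′ = b′q + r` with `q, r ∈ A` and `φ(r) < φ(b′)`.  Therefore `a ≡ (s/t) r (mod S⁻¹Ab)`, and we have
  `φ′((s/t) r) = φ′(r) ≤ φ(r) < φ(b′) = φ′(b)`.»  §5 Example (4) (p. 293): «if we write each `x ∈ S⁻¹A`, `x ≠ 0` under
  the form `x = (s/t) x′` … then the mapping `n′` defined by `n′(x) = n(x′)` is an algorithm on `S⁻¹A`.»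
* P. L. Clark, *A note on Euclidean order types*, Order **32** (2015) 157–178 [Clark2015EuclideanOrderTypes]
  (materialised `paper:arxiv-1208.0977`, arXiv numbering), §2.6 «The Localized Euclidean Function», VERBATIM:
  «Theorem 18. Let `R` be a Euclidean domain, and let `S ⊂ R` be a multiplicatively closed subset.  Then the
  localization `S⁻¹R` is Euclidean and `e(S⁻¹R) ≤ e(R)`.  Proof. See [Motzkin49] or Samuel [Samuel71].»  (Clark's
  bottom Euclidean function `φ_R` is `θ − 1` on non-zero elements and `e(R)` is the least strict upper bound of its
  values, `⨆ z, ((θ z − 1) + 1)` as in `EuclideanOrderTypeIndecomposable.lean`; §2.5 Example: «`e(ℤ) = ω`».)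

## What is formalised (and in what generality)

The proofs below run Samuel's division step `a′ = b′q + r ⟹ a ≡ (s/t) r` directly on numerators; this needs neither
«domain» nor `0 ∉ S`, so §1–§2 are stated for an ARBITRARY commutative ring `A`, an arbitrary submonoid `M` and any
localization `B` of `A` at `M` (Mathlib's `IsLocalization M B`); Samuel's and Clark's statements are the special cases
recorded in §3.
* §1 (Prop. 7, the algorithm) for ANY algorithm `φ : A → W` (`W` a well-ordered conditionally complete linear order,
  e.g. `ℕ` or the ordinals), the function `φ′(X) = min {φ(y) : y ∈ A, y/1 associated to X}` is an algorithm on `B`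
  (**`IsLocalization.algorithm_sInf`**), with `φ′(a/1) ≤ φ(a)` (`IsLocalization.sInf_algebraMap_le`); hence
  `IsLocalization.exists_algorithm`.  Samuel's own formula is recovered as a theorem: for a normalised `φ`
  («`y ∈ Ax, y ≠ 0 ⟹ φ(x) ≤ φ(y)`») and `x′` coprime to every element of `M`, `φ′(u · x′/1) = φ(x′)` for every unit `u`
  of `B` — in particular for `u = s/t` (**`IsLocalization.sInf_eq_of_forall_isCoprime`**).
* §2 (Thm. 18, transfinite form) `a ∈ A_α(A) ⟹ a/1 ∈ A_α(B)` (**`IsLocalization.algebraMap_mem_samuelSet`**, by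
  transfinite induction: the classes mod `a/1` are the classes mod `a` up to the units `s/1`), so `θ_B(a/s) ≤ θ_A(a)`
  (`IsLocalization.samuelRank_mk'_le`), the transfinite construction of `B` exhausts `B` as soon as that of `A`
  exhausts `A` (`IsLocalization.forall_exists_mem_samuelSet`, stage by stage `IsLocalization.samuelSet_eq_univ`), the
  finite stages of `B` exhaust `B` if those of `A` exhaust `A` (so ordinary, `ℕ`-valued, Euclidean functions descend:
  `IsLocalization.exists_euclideanFunction`), and **`e(B) ≤ e(A)`** (**`IsLocalization.iSup_samuelRank_le`**).
* §3 Mathlib's `EuclideanDomain`: for a Euclidean domain `A` and `M ≤ A⁰` (i.e. `0 ∉ S`), every localization of `A`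
  at `M` — in particular `Localization M` — is ring-isomorphic to a Mathlib Euclidean domain
  (**`IsLocalization.exists_euclideanDomain`**, `exists_euclideanDomain_localization`): Prop. 7 / Thm. 18 as printed.
* §4 Example `ℤ[1/2] = Localization.Away 2`: it is exhausted by its finite stages, `5` is a universal side divisor there
  (`θ(5) = 2 < 3 = θ_ℤ(5)`: the inequality of §2 can be strict), `3` is not a unit, and `e(ℤ[1/2]) = ω = e(ℤ)`
  (**`IntAwayTwo.iSup_samuelRank_eq_omega0`**).
-- TODO(general form): Samuel's §5 Example (4) second clause («`n′` is actually the norm on `S⁻¹A`», the isomorphism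
-- `A/Ax′ → S⁻¹A/S⁻¹Ax`) is not formalised here.

## Mathlib / tree search

Mathlib: `IsLocalization.surj`, `IsLocalization.map_units`, `IsLocalization.mk'_spec`, `IsLocalization.eq_iff_exists`,
`IsLocalization.injective`, `IsLocalization.isDomain_of_le_nonZeroDivisors`, `Localization.Away`, `Associated`,
`IsCoprime.dvd_of_dvd_mul_left`, `csInf_mem` / `csInf_le` (well-founded conditionally complete linear orders); Mathlib has
no statement that a localization of a Euclidean domain is Euclidean (`rg EuclideanDomain Mathlib/RingTheory/Localization`
→ nothing).  Tree: `TransfiniteSmallestAlgorithm.lean` (`mem_samuelSet_iff`, `samuelRank_le_of_mem`,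
`mem_samuelSet_samuelRank`, `samuelRank_eq_two_iff`, `exists_euclideanFunction_iff_iUnion_samuelSet_natCast`,
`Int.samuelRank_eq`, `Int.iUnion_samuelSet_natCast`), `IntProdIntSmallestAlgorithm.lean` (the pattern: surjections map
stages into stages, `mem_samuelSet_map_of_surjective`), `EuclideanDomainIffTransfiniteConstruction.lean`
(`forall_exists_mem_samuelSet_of_euclideanDomain`, `exists_euclideanDomain_of_forall_exists_mem_samuelSet`),
`EuclideanOrderTypeProduct.lean` (`omega0_le_iSup_samuelRank_of_not_isUnit`), `EuclideanOrderTypeIndecomposable.lean`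
(`Int.iSup_samuelRank_eq_omega0`), `UniversalSideDivisors.lean` (`IsUniversalSideDivisor`).
-/

namespace Literature.Algebra.EuclideanDomain

universe u

open Ordinal

/-! ## §1 Proposition 7: an algorithm on `A` induces an algorithm on every ring of fractions of `A` -/

section Algorithm

variable {A : Type*} [CommRing A] {B : Type*} [CommRing B] [Algebra A B]

/-- A unit multiple of `y/1` is still a unit multiple of `y/1` after multiplication by `1/s`: the candidate numerators of
`X` and of `u • X` agree for every unit `u`. [cite: Samuel1971, Prop. 7 (proof, p. 287: «`φ′(sx/s′) = φ′(x)`»)] -/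
theorem IsLocalization.setOf_associated_mul_eq_of_isUnit {u : B} (hu : IsUnit u) (X : B) :
    {y : A | Associated (algebraMap A B y) (u * X)} = {y : A | Associated (algebraMap A B y) X} := by
  ext y
  simp only [Set.mem_setOf_eq]
  have h : Associated (u * X) X := associated_unit_mul_left X u hu
  exact ⟨fun hy ↦ hy.trans h, fun hy ↦ hy.trans h.symm⟩

/-- `φ′(a/1) ≤ φ(a)`: `a` is a candidate numerator of `a/1`. [cite: Samuel1971, Prop. 7 (proof, p. 287);
Clark2015EuclideanOrderTypes, Thm. 18] -/
theorem IsLocalization.sInf_algebraMap_le {W : Type*} [ConditionallyCompleteLinearOrder W] [WellFoundedLT W]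
    (φ : A → W) (a : A) :
    sInf (φ '' {y : A | Associated (algebraMap A B y) (algebraMap A B a)}) ≤ φ a := by
  haveI : Nonempty W := ⟨φ a⟩
  letI : OrderBot W := WellFoundedLT.toOrderBot W
  exact csInf_le (OrderBot.bddBelow _) ⟨a, Associated.refl _, rfl⟩

variable (M : Submonoid A) [IsLocalization M B]

include M

/-- Every element `X` of a localization is a unit multiple of some `y/1`, `y ∈ A` («every element `x` of `S⁻¹A` can be
written as `x = (s/t)·x′`»). [cite: Samuel1971, Prop. 7 (proof, p. 287)] -/
theorem IsLocalization.exists_associated_algebraMap (X : B) : ∃ y : A, Associated (algebraMap A B y) X := by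
  obtain ⟨⟨x, s⟩, h⟩ := IsLocalization.surj M X
  obtain ⟨u, hu⟩ := IsLocalization.map_units B s
  refine ⟨x, u⁻¹, ?_⟩
  rw [← h, ← hu, mul_assoc, Units.mul_inv, mul_one]

/-- **Proposition 7 (the algorithm).**  Let `φ : A → W` be an algorithm on a commutative ring `A` (`W` well ordered) and
`B` a ring of fractions of `A`.  Then `φ′(X) = min {φ(y) : y ∈ A, y/1 associated to X}` is an algorithm on `B`: given
`X = x/s` and `Y ≠ 0` with minimising numerator `y` (`Y = v · y/1`, `v` a unit), write `x = yq + r` with `φ(r) < φ(y)`;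
then `X = Y · (v⁻¹ q/s) + r/s` and `φ′(r/s) ≤ φ(r) < φ(y) = φ′(Y)` («`φ′((s/t) r) = φ′(r) ≤ φ(r) < φ(b′) = φ′(b)`»).
Samuel states this for a Euclidean DOMAIN and `0 ∉ S`, with `φ′` computed on the `S`-free part; the division step needs
neither hypothesis. [cite: Samuel1971, Prop. 7 (p. 287); Clark2015EuclideanOrderTypes, Thm. 18] -/
theorem IsLocalization.algorithm_sInf {W : Type*} [ConditionallyCompleteLinearOrder W] [WellFoundedLT W] (φ : A → W)
    (hφ : ∀ a b : A, b ≠ 0 → ∃ q r : A, a = b * q + r ∧ φ r < φ b) :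
    ∀ X Y : B, Y ≠ 0 → ∃ Q R : B, X = Y * Q + R ∧
      sInf (φ '' {y : A | Associated (algebraMap A B y) R}) <
        sInf (φ '' {y : A | Associated (algebraMap A B y) Y}) := by
  intro X Y hY
  -- a minimising numerator `y` of `Y`
  have hne : (φ '' {y : A | Associated (algebraMap A B y) Y}).Nonempty := by
    obtain ⟨y, hy⟩ := IsLocalization.exists_associated_algebraMap M Y
    exact ⟨φ y, y, hy, rfl⟩
  obtain ⟨y, hyY, hy⟩ := csInf_mem hne
  have hy0 : y ≠ 0 := by
    rintro rfl
    rw [Set.mem_setOf_eq, map_zero] at hyY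
    exact hY ((associated_zero_iff_eq_zero Y).1 hyY.symm)
  obtain ⟨v, hv⟩ := hyY
  -- `X = x/s`
  obtain ⟨⟨x, s⟩, hxs⟩ := IsLocalization.surj M X
  obtain ⟨u, hu⟩ := IsLocalization.map_units B s
  -- divide the numerators in `A`
  obtain ⟨q, r, hqr, hr⟩ := hφ x y hy0
  haveI : Nonempty W := ⟨φ y⟩
  letI : OrderBot W := WellFoundedLT.toOrderBot W
  refine ⟨↑v⁻¹ * ↑u⁻¹ * algebraMap A B q, ↑u⁻¹ * algebraMap A B r, ?_, ?_⟩
  · have hX : X = ↑u⁻¹ * algebraMap A B x := by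
      rw [← hxs, ← hu, mul_comm X, ← mul_assoc, Units.inv_mul, one_mul]
    rw [hX, hqr, map_add, map_mul, ← hv]
    simp only [mul_add]
    rw [show algebraMap A B y * ↑v * (↑v⁻¹ * ↑u⁻¹ * algebraMap A B q) =
        algebraMap A B y * (↑v * ↑v⁻¹) * ↑u⁻¹ * algebraMap A B q by ring, Units.mul_inv, mul_one]
    ring
  · calc sInf (φ '' {y : A | Associated (algebraMap A B y) (↑u⁻¹ * algebraMap A B r)})
        ≤ φ r := csInf_le (OrderBot.bddBelow _) ⟨r, associated_unit_mul_left _ _ (Units.isUnit _) |>.symm, rfl⟩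
      _ < φ y := hr
      _ = _ := hy

/-- **Proposition 7 / Theorem 18 (existence form): «Then `S⁻¹A` is Euclidean»** — a ring of fractions of a ring with an
algorithm (values in a well-ordered `W`) has an algorithm with values in the same `W`, bounded by `φ` on `A`.
[cite: Samuel1971, Prop. 7 (p. 287); Clark2015EuclideanOrderTypes, Thm. 18] -/
theorem IsLocalization.exists_algorithm {W : Type*} [ConditionallyCompleteLinearOrder W] [WellFoundedLT W]
    (φ : A → W) (hφ : ∀ a b : A, b ≠ 0 → ∃ q r : A, a = b * q + r ∧ φ r < φ b) :
    ∃ ψ : B → W, (∀ X Y : B, Y ≠ 0 → ∃ Q R : B, X = Y * Q + R ∧ ψ R < ψ Y) ∧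
      ∀ a : A, ψ (algebraMap A B a) ≤ φ a :=
  ⟨fun X ↦ sInf (φ '' {y : A | Associated (algebraMap A B y) X}), IsLocalization.algorithm_sInf M φ hφ,
    IsLocalization.sInf_algebraMap_le φ⟩

/-- If `y/1` is associated to `u · x′/1` (`u` a unit of `B`) and `x′` is coprime to every element of `M` («`x′ ∈ A` prime
to all elements of `S`»), then `x′ ∣ y` in `A`. [cite: Samuel1971, Prop. 7 (proof, p. 287: «`x′` is uniquely determined
up to units by `x`»)] -/
theorem IsLocalization.dvd_of_associated_of_forall_isCoprime {x y : A} (hx : ∀ m ∈ M, IsCoprime x m) {u : B}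
    (hu : IsUnit u) (h : Associated (algebraMap A B y) (u * algebraMap A B x)) : x ∣ y := by
  have h' : Associated (algebraMap A B x) (algebraMap A B y) := (h.trans (associated_unit_mul_left _ u hu)).symm
  obtain ⟨w, hw⟩ := h'
  -- `w = c/t`, so `x c / t = y/1`, i.e. `m (x c) = m (y t)` for some `m ∈ M`
  obtain ⟨⟨c, t⟩, hct⟩ := IsLocalization.surj M (w : B)
  have key : algebraMap A B (x * c) = algebraMap A B (y * t) := by
    rw [map_mul, map_mul, ← hct, ← mul_assoc, hw]
  obtain ⟨m, hm⟩ := (IsLocalization.eq_iff_exists M B).1 key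
  -- `x ∣ (m t) y` with `x` coprime to `m t ∈ M`
  have hdvd : x ∣ (↑m * ↑t) * y := ⟨↑m * c, by linear_combination -hm⟩
  exact (hx _ (M.mul_mem m.2 t.2)).dvd_of_dvd_mul_left hdvd

/-- **Samuel's formula `φ′((s/t) x′) = φ(x′)`.**  For a normalised algorithm `φ` («`y ∈ Ax`, `y ≠ 0` implies
`φ(x) ≤ φ(y)`», Prop. 4) and `x′` coprime to every element of `M` with `x′/1 ≠ 0`, the induced function takes the value
`φ(x′)` at every unit multiple `u · x′/1` — in particular at `(s/t) x′`. [cite: Samuel1971, Prop. 7 (proof, p. 287)] -/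
theorem IsLocalization.sInf_eq_of_forall_isCoprime {W : Type*} [ConditionallyCompleteLinearOrder W] [WellFoundedLT W]
    (φ : A → W) (hmono : ∀ a c : A, a * c ≠ 0 → φ a ≤ φ (a * c)) {x : A} (hx : ∀ m ∈ M, IsCoprime x m)
    (hx0 : algebraMap A B x ≠ 0) {u : B} (hu : IsUnit u) :
    sInf (φ '' {y : A | Associated (algebraMap A B y) (u * algebraMap A B x)}) = φ x := by
  haveI : Nonempty W := ⟨φ x⟩
  letI : OrderBot W := WellFoundedLT.toOrderBot W
  refine le_antisymm (csInf_le (OrderBot.bddBelow _) ⟨x, (associated_unit_mul_left _ u hu).symm, rfl⟩) ?_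
  have hne : (φ '' {y : A | Associated (algebraMap A B y) (u * algebraMap A B x)}).Nonempty :=
    ⟨φ x, x, (associated_unit_mul_left _ u hu).symm, rfl⟩
  refine le_csInf hne ?_
  rintro _ ⟨y, hy, rfl⟩
  obtain ⟨k, rfl⟩ := IsLocalization.dvd_of_associated_of_forall_isCoprime M hx hu hy
  refine hmono x k fun h0 ↦ hx0 ?_
  -- `x k = 0` forces `u · x/1 ~ 0`, i.e. `x/1 = 0`
  have : Associated (0 : B) (u * algebraMap A B x) := by simpa [h0] using hy
  have h := (associated_zero_iff_eq_zero _).1 this.symm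
  exact (hu.mul_right_eq_zero).1 h

end Algorithm

/-! ## §2 Theorem 18: stages map into stages, `θ_B(a/s) ≤ θ_A(a)`, `e(S⁻¹A) ≤ e(A)` -/

section Stages

variable {R : Type u} [CommRing R]

/-- Stage membership depends only on the class of associates («the value of `φ_A` at `x` depends only on `(x)`», here
for the stages themselves: `b ∣ a − r` is invariant under unit multiples of `b`). [cite: Clark2015EuclideanOrderTypes,
Prop. 15; Samuel1971, §4 (p. 289)] -/
theorem mem_samuelSet_of_associated {b b' : R} (h : Associated b b') {α : Ordinal.{u}} (hb : b ∈ samuelSet R α) :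
    b' ∈ samuelSet R α := by
  rcases mem_samuelSet_iff.1 hb with rfl | H
  · rw [(associated_zero_iff_eq_zero b').1 h.symm]
    exact zero_mem_samuelSet α
  · exact mem_samuelSet_of_forall fun a ↦ by
      obtain ⟨β, hβ, r, hr, hd⟩ := H a
      exact ⟨β, hβ, r, hr, h.dvd_iff_dvd_left.1 hd⟩

/-- `θ` is constant on associates. [cite: Clark2015EuclideanOrderTypes, Prop. 15; Samuel1971, §4 (p. 289)] -/
theorem samuelRank_eq_of_associated {b b' : R} (h : Associated b b') : samuelRank b = samuelRank b' := by
  unfold samuelRank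
  congr 1
  ext α
  exact ⟨mem_samuelSet_of_associated h, mem_samuelSet_of_associated h.symm⟩

variable {A : Type u} [CommRing A] (M : Submonoid A) {B : Type u} [CommRing B] [Algebra A B] [IsLocalization M B]

include M

/-- **Theorem 18, transfinite form: `a ∈ A_α(A) ⟹ a/1 ∈ A_α(B)`.**  By transfinite induction on `α`: a class
`X + B·(a/1)`, `X = x/s`, is `(1/s) · (x + Aa)·B`; if `r ∈ A_β(A)` represents `x` mod `a` (`β < α`), then `r/s`, a unit
multiple of `r/1 ∈ A_β(B)`, represents `X` mod `a/1`. [cite: Clark2015EuclideanOrderTypes, Thm. 18; Samuel1971, Prop. 7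
(proof, p. 287: «`a ≡ (s/t) r (mod S⁻¹Ab)`»)] -/
theorem IsLocalization.algebraMap_mem_samuelSet {α : Ordinal.{u}} :
    ∀ {a : A}, a ∈ samuelSet A α → algebraMap A B a ∈ samuelSet B α := by
  induction α using WellFoundedLT.induction with
  | ind α ih =>
    intro a ha
    rcases mem_samuelSet_iff.1 ha with rfl | H
    · rw [map_zero]
      exact zero_mem_samuelSet α
    · refine mem_samuelSet_of_forall fun X ↦ ?_
      obtain ⟨⟨x, s⟩, hxs⟩ := IsLocalization.surj M X
      obtain ⟨u, hu⟩ := IsLocalization.map_units B s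
      obtain ⟨β, hβ, r, hr, c, hc⟩ := H x
      refine ⟨β, hβ, ↑u⁻¹ * algebraMap A B r,
        mem_samuelSet_of_associated (associated_unit_mul_left _ _ (Units.isUnit u⁻¹)).symm (ih β hβ hr),
        ⟨↑u⁻¹ * algebraMap A B c, ?_⟩⟩
      have hX : X = ↑u⁻¹ * algebraMap A B x := by
        rw [← hxs, ← hu, mul_comm X, ← mul_assoc, Units.inv_mul, one_mul]
      rw [hX, ← _root_.mul_sub, ← map_sub, hc, map_mul]
      ring

/-- If `y ∈ A_α(A)` and `y/1` is associated to `X`, then `X ∈ A_α(B)`. [cite: Clark2015EuclideanOrderTypes, Thm. 18] -/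
theorem IsLocalization.mem_samuelSet_of_associated_algebraMap {X : B} {y : A} (hX : Associated (algebraMap A B y) X)
    {α : Ordinal.{u}} (hy : y ∈ samuelSet A α) : X ∈ samuelSet B α :=
  mem_samuelSet_of_associated hX (IsLocalization.algebraMap_mem_samuelSet M hy)

/-- `x/s ∈ A_α(B)` for `x ∈ A_α(A)`. [cite: Clark2015EuclideanOrderTypes, Thm. 18] -/
theorem IsLocalization.mk'_mem_samuelSet {x : A} (s : M) {α : Ordinal.{u}} (hx : x ∈ samuelSet A α) :
    IsLocalization.mk' B x s ∈ samuelSet B α := by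
  obtain ⟨u, hu⟩ := IsLocalization.map_units B s
  refine IsLocalization.mem_samuelSet_of_associated_algebraMap M ⟨u⁻¹, ?_⟩ hx
  rw [← IsLocalization.mk'_spec B x s, ← hu, mul_assoc, Units.mul_inv, mul_one]

/-- **«Then the localization `S⁻¹R` is Euclidean»** (transfinite form): if the transfinite construction exhausts `A`, it
exhausts every ring of fractions of `A`. [cite: Clark2015EuclideanOrderTypes, Thm. 18; Samuel1971, Prop. 7 (p. 287)] -/
theorem IsLocalization.forall_exists_mem_samuelSet (h : ∀ a : A, ∃ α : Ordinal.{u}, a ∈ samuelSet A α) :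
    ∀ X : B, ∃ α : Ordinal.{u}, X ∈ samuelSet B α := by
  intro X
  obtain ⟨y, hy⟩ := IsLocalization.exists_associated_algebraMap M X
  obtain ⟨α, hα⟩ := h y
  exact ⟨α, IsLocalization.mem_samuelSet_of_associated_algebraMap M hy hα⟩

/-- Stage by stage: `A_α(A) = A ⟹ A_α(B) = B`. [cite: Clark2015EuclideanOrderTypes, Thm. 18] -/
theorem IsLocalization.samuelSet_eq_univ {α : Ordinal.{u}} (h : samuelSet A α = Set.univ) :
    samuelSet B α = Set.univ := by
  refine Set.eq_univ_of_forall fun X ↦ ?_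
  obtain ⟨y, hy⟩ := IsLocalization.exists_associated_algebraMap M X
  exact IsLocalization.mem_samuelSet_of_associated_algebraMap M hy (h ▸ Set.mem_univ y)

/-- `θ_B(X) ≤ θ_A(y)` whenever `y/1` is associated to `X` (and `y ∈ A′`). [cite: Clark2015EuclideanOrderTypes, Thm. 18;
Samuel1971, Prop. 7 (p. 287)] -/
theorem IsLocalization.samuelRank_le_of_associated {X : B} {y : A} (hX : Associated (algebraMap A B y) X)
    (hy : ∃ α : Ordinal.{u}, y ∈ samuelSet A α) : samuelRank X ≤ samuelRank y :=
  samuelRank_le_of_mem (IsLocalization.mem_samuelSet_of_associated_algebraMap M hX (mem_samuelSet_samuelRank hy))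

/-- **`θ_B(a/1) ≤ θ_A(a)`** (for `a ∈ A′`): the localized smallest algorithm is bounded by the smallest algorithm of `A`.
[cite: Clark2015EuclideanOrderTypes, Thm. 18; Samuel1971, Prop. 7 (p. 287)] -/
theorem IsLocalization.samuelRank_algebraMap_le {a : A} (ha : ∃ α : Ordinal.{u}, a ∈ samuelSet A α) :
    samuelRank (algebraMap A B a) ≤ samuelRank a :=
  samuelRank_le_of_mem (IsLocalization.algebraMap_mem_samuelSet M (mem_samuelSet_samuelRank ha))

/-- `θ_B(x/s) ≤ θ_A(x)` (for `x ∈ A′`). [cite: Clark2015EuclideanOrderTypes, Thm. 18; Samuel1971, Prop. 7 (p. 287)] -/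
theorem IsLocalization.samuelRank_mk'_le {x : A} (s : M) (hx : ∃ α : Ordinal.{u}, x ∈ samuelSet A α) :
    samuelRank (IsLocalization.mk' B x s) ≤ samuelRank x :=
  samuelRank_le_of_mem (IsLocalization.mk'_mem_samuelSet M s (mem_samuelSet_samuelRank hx))

/-- **Theorem 18: «`e(S⁻¹R) ≤ e(R)`»** — the Euclidean order type `⨆ z, ((θ z − 1) + 1)` of a ring of fractions of `A`
does not exceed that of `A` (for `A` exhausted by its construction). [cite: Clark2015EuclideanOrderTypes, Thm. 18] -/
theorem IsLocalization.iSup_samuelRank_le (h : ∀ a : A, ∃ α : Ordinal.{u}, a ∈ samuelSet A α) :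
    (⨆ X : B, (samuelRank X - 1 + 1)) ≤ ⨆ a : A, (samuelRank a - 1 + 1) := by
  refine Ordinal.iSup_le fun X ↦ ?_
  obtain ⟨y, hy⟩ := IsLocalization.exists_associated_algebraMap M X
  have hle : samuelRank X - 1 + 1 ≤ samuelRank y - 1 + 1 :=
    add_le_add (Ordinal.sub_le.2 ((IsLocalization.samuelRank_le_of_associated M hy (h y)).trans
      (Ordinal.le_add_sub _ _))) le_rfl
  exact hle.trans (Ordinal.le_iSup (fun a : A ↦ samuelRank a - 1 + 1) y)

/-- `θ_B` is bounded by every ordinal bounding `θ_A` (e.g. `θ_A < ω ⟹ θ_B < ω`: finitely valued smallest algorithms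
descend). [cite: Clark2015EuclideanOrderTypes, Thm. 18] -/
theorem IsLocalization.samuelRank_lt_of_forall_lt (h : ∀ a : A, ∃ α : Ordinal.{u}, a ∈ samuelSet A α)
    {γ : Ordinal.{u}} (hγ : ∀ a : A, samuelRank a < γ) (X : B) : samuelRank X < γ := by
  obtain ⟨y, hy⟩ := IsLocalization.exists_associated_algebraMap M X
  exact (IsLocalization.samuelRank_le_of_associated M hy (h y)).trans_lt (hγ y)

/-- The finite stages: `⋃ₙ A_n(A) = A ⟹ ⋃ₙ A_n(B) = B`. [cite: Clark2015EuclideanOrderTypes, Thm. 18; Samuel1971, Prop. 7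
(p. 287)] -/
theorem IsLocalization.iUnion_samuelSet_natCast_eq_univ (h : (⋃ n : ℕ, samuelSet A n) = Set.univ) :
    (⋃ n : ℕ, samuelSet B n) = Set.univ := by
  refine Set.eq_univ_of_forall fun X ↦ ?_
  obtain ⟨y, hy⟩ := IsLocalization.exists_associated_algebraMap M X
  obtain ⟨n, hn⟩ := Set.mem_iUnion.1 (h ▸ Set.mem_univ y : y ∈ ⋃ n : ℕ, samuelSet A n)
  exact Set.mem_iUnion.2 ⟨n, IsLocalization.mem_samuelSet_of_associated_algebraMap M hy hn⟩

/-- **Ordinary Euclidean functions descend**: if `A` is Euclidean for an `ℕ`-valued function (Motzkin's form `a = bq + s`,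
`s = 0` or `φ(s) < φ(b)`), so is every ring of fractions of `A`. [cite: Samuel1971, Prop. 7 (p. 287) and §5 Example (4)
(p. 293); Clark2015EuclideanOrderTypes, Thm. 18] -/
theorem IsLocalization.exists_euclideanFunction
    (h : ∃ φ : A → ℕ, ∀ a b : A, b ≠ 0 → ∃ q s : A, a = b * q + s ∧ (s = 0 ∨ φ s < φ b)) :
    ∃ φ : B → ℕ, ∀ a b : B, b ≠ 0 → ∃ q s : B, a = b * q + s ∧ (s = 0 ∨ φ s < φ b) :=
  exists_euclideanFunction_iff_iUnion_samuelSet_natCast.2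
    (IsLocalization.iUnion_samuelSet_natCast_eq_univ M (exists_euclideanFunction_iff_iUnion_samuelSet_natCast.1 h))

/-- The smallest algorithm of `B` is an algorithm as soon as `A` is exhausted by its construction.
[cite: Clark2015EuclideanOrderTypes, Thm. 18; Samuel1971, Prop. 7 (p. 287)] -/
theorem IsLocalization.samuelRank_isAlgorithm (h : ∀ a : A, ∃ α : Ordinal.{u}, a ∈ samuelSet A α) :
    ∀ X Y : B, Y ≠ 0 → ∃ Q R : B, X = Y * Q + R ∧ samuelRank R < samuelRank Y :=
  Literature.Algebra.EuclideanDomain.samuelRank_isAlgorithm (IsLocalization.forall_exists_mem_samuelSet M h)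

end Stages

/-! ## §3 Proposition 7 / Theorem 18 as printed: Mathlib Euclidean domains -/

section Mathlib

variable {A : Type u} [EuclideanDomain A] (M : Submonoid A) {B : Type u} [CommRing B] [Algebra A B]
  [IsLocalization M B]

include M

/-- A ring of fractions of a Mathlib Euclidean domain is exhausted by its transfinite construction.
[cite: Samuel1971, Prop. 7 (p. 287); Clark2015EuclideanOrderTypes, Thm. 18] -/
theorem IsLocalization.forall_exists_mem_samuelSet_of_euclideanDomain :
    ∀ X : B, ∃ α : Ordinal.{u}, X ∈ samuelSet B α :=
  IsLocalization.forall_exists_mem_samuelSet M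
    Literature.Algebra.EuclideanDomain.forall_exists_mem_samuelSet_of_euclideanDomain

/-- **Proposition 7. «Let `A` be a Euclidean domain, and `S ⊂ A` a multiplicatively closed set (such that `0 ∉ S`).
Then `S⁻¹A` is Euclidean.»** — with «Euclidean» read as Mathlib's `EuclideanDomain` (up to ring isomorphism) and
`0 ∉ S` as `M ≤ A⁰`. [cite: Samuel1971, Prop. 7 (p. 287); Clark2015EuclideanOrderTypes, Thm. 18] -/
theorem IsLocalization.exists_euclideanDomain (hM : M ≤ nonZeroDivisors A) :
    ∃ (E : Type u) (_ : EuclideanDomain E), Nonempty (E ≃+* B) := by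
  haveI : IsDomain B := IsLocalization.isDomain_of_le_nonZeroDivisors B hM
  exact exists_euclideanDomain_of_forall_exists_mem_samuelSet
    (IsLocalization.forall_exists_mem_samuelSet_of_euclideanDomain M)

/-- Proposition 7 for the ring of fractions `Localization M` itself. [cite: Samuel1971, Prop. 7 (p. 287);
Clark2015EuclideanOrderTypes, Thm. 18] -/
theorem exists_euclideanDomain_localization (hM : M ≤ nonZeroDivisors A) :
    ∃ (E : Type u) (_ : EuclideanDomain E), Nonempty (E ≃+* Localization M) :=
  IsLocalization.exists_euclideanDomain M hM

/-- **Theorem 18: «and `e(S⁻¹R) ≤ e(R)`»** for a Mathlib Euclidean domain `R = A`.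
[cite: Clark2015EuclideanOrderTypes, Thm. 18] -/
theorem IsLocalization.iSup_samuelRank_le_of_euclideanDomain :
    (⨆ X : B, (samuelRank X - 1 + 1)) ≤ ⨆ a : A, (samuelRank a - 1 + 1) :=
  IsLocalization.iSup_samuelRank_le M
    Literature.Algebra.EuclideanDomain.forall_exists_mem_samuelSet_of_euclideanDomain

/-- The Euclidean algorithm of a Mathlib Euclidean domain descends: every ring of fractions of `A` carries an `ℕ`-valued
Euclidean function whenever `A` does (Motzkin's form). [cite: Samuel1971, Prop. 7 (p. 287) and §5 Example (4) (p. 293)] -/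
theorem IsLocalization.exists_euclideanFunction_of_euclideanDomain
    (h : ∃ φ : A → ℕ, ∀ a b : A, b ≠ 0 → ∃ q s : A, a = b * q + s ∧ (s = 0 ∨ φ s < φ b)) :
    ∃ φ : B → ℕ, ∀ a b : B, b ≠ 0 → ∃ q s : B, a = b * q + s ∧ (s = 0 ∨ φ s < φ b) :=
  IsLocalization.exists_euclideanFunction M h

end Mathlib

/-! ## §4 Example: `ℤ[1/2]`, `θ(5) = 2 < θ_ℤ(5) = 3`, `e(ℤ[1/2]) = ω` -/

section IntAwayTwo

/-- In `ℤ[1/2]` an integer `a` becomes a unit iff `a ∣ 2ⁿ` for some `n`; in particular `a/1` a unit forces `a` odd-free: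
here the elementary half — `a/1` a unit `⟹ a ∣ 2ⁿ` for some `n`. [cite: Clark2015EuclideanOrderTypes, Thm. 18
(context: localizations)] -/
theorem IntAwayTwo.exists_dvd_pow_of_isUnit {a : ℤ} (h : IsUnit (algebraMap ℤ (Localization.Away (2 : ℤ)) a)) :
    ∃ n : ℕ, a ∣ 2 ^ n := by
  obtain ⟨w, hw⟩ := h.exists_right_inv
  obtain ⟨⟨c, ⟨t, n, rfl⟩⟩, hct⟩ := IsLocalization.surj (Submonoid.powers (2 : ℤ)) w
  -- `w = c / 2ⁿ`, so `a c = 2ⁿ` in `ℤ` (the map `ℤ → ℤ[1/2]` is injective)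
  have key : algebraMap ℤ (Localization.Away (2 : ℤ)) (a * c) =
      algebraMap ℤ (Localization.Away (2 : ℤ)) (2 ^ n) := by
    rw [map_mul, ← hct, ← mul_assoc, hw, one_mul]
  have hinj : Function.Injective (algebraMap ℤ (Localization.Away (2 : ℤ))) :=
    IsLocalization.injective _ (powers_le_nonZeroDivisors_of_noZeroDivisors two_ne_zero)
  exact ⟨n, c, (hinj key).symm⟩

/-- `3` is not a unit of `ℤ[1/2]` (`3 ∤ 2ⁿ`). [cite: Clark2015EuclideanOrderTypes, Thm. 18 (context)] -/
theorem IntAwayTwo.not_isUnit_three : ¬IsUnit (algebraMap ℤ (Localization.Away (2 : ℤ)) 3) := by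
  intro h
  obtain ⟨n, hn⟩ := IntAwayTwo.exists_dvd_pow_of_isUnit h
  have h3 : ∀ k : ℕ, ¬(3 : ℤ) ∣ 2 ^ k := fun k ↦ by
    induction k with
    | zero => decide
    | succ k ih => rw [pow_succ]; omega
  exact h3 n hn

/-- `5` is not a unit of `ℤ[1/2]` (`5 ∤ 2ⁿ`). [cite: Clark2015EuclideanOrderTypes, Thm. 18 (context)] -/
theorem IntAwayTwo.not_isUnit_five : ¬IsUnit (algebraMap ℤ (Localization.Away (2 : ℤ)) 5) := by
  intro h
  obtain ⟨n, hn⟩ := IntAwayTwo.exists_dvd_pow_of_isUnit h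
  have h5 : ∀ k : ℕ, ¬(5 : ℤ) ∣ 2 ^ k := fun k ↦ by
    induction k with
    | zero => decide
    | succ k ih => rw [pow_succ]; omega
  exact h5 n hn

/-- `ℤ[1/2]` is not the zero ring and `3/1 ≠ 0`, `5/1 ≠ 0`: the structure map is injective.
[cite: Clark2015EuclideanOrderTypes, Thm. 18 (context)] -/
theorem IntAwayTwo.algebraMap_injective :
    Function.Injective (algebraMap ℤ (Localization.Away (2 : ℤ))) :=
  IsLocalization.injective _ (powers_le_nonZeroDivisors_of_noZeroDivisors two_ne_zero)

/-- **`5` is a universal side divisor of `ℤ[1/2]`**: every class mod `5` contains `0` or one of the units `±1, ±2`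
(symmetric remainders of the numerator mod `5`, divided by the unit `2ⁿ`). [cite: Samuel1971, §4 (4.6) (p. 289);
Clark2015EuclideanOrderTypes, Thm. 18] -/
theorem IntAwayTwo.isUniversalSideDivisor_five :
    IsUniversalSideDivisor (algebraMap ℤ (Localization.Away (2 : ℤ)) 5) := by
  set B := Localization.Away (2 : ℤ)
  refine ⟨fun h ↦ ?_, IntAwayTwo.not_isUnit_five, fun X ↦ ?_⟩
  · exact (by norm_num : (5 : ℤ) ≠ 0) (IntAwayTwo.algebraMap_injective (by rw [h, map_zero]))
  · obtain ⟨⟨x, s⟩, hxs⟩ := IsLocalization.surj (Submonoid.powers (2 : ℤ)) X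
    obtain ⟨u, hu⟩ := IsLocalization.map_units B s
    -- symmetric remainder of `x` mod `5`
    obtain ⟨r, hr, hdvd⟩ : ∃ r : ℤ, (r = 0 ∨ r = 1 ∨ r = -1 ∨ r = 2 ∨ r = -2) ∧ (5 : ℤ) ∣ x - r := by
      have h5 : x % 5 = 0 ∨ x % 5 = 1 ∨ x % 5 = 2 ∨ x % 5 = 3 ∨ x % 5 = 4 := by omega
      rcases h5 with h | h | h | h | h
      · exact ⟨0, Or.inl rfl, by omega⟩
      · exact ⟨1, Or.inr (Or.inl rfl), by omega⟩
      · exact ⟨2, Or.inr (Or.inr (Or.inr (Or.inl rfl))), by omega⟩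
      · exact ⟨-2, Or.inr (Or.inr (Or.inr (Or.inr rfl))), by omega⟩
      · exact ⟨-1, Or.inr (Or.inr (Or.inl rfl)), by omega⟩
    have hX : X = ↑u⁻¹ * algebraMap ℤ B x := by
      rw [← hxs, ← hu, mul_comm X, ← mul_assoc, Units.inv_mul, one_mul]
    refine ⟨↑u⁻¹ * algebraMap ℤ B r, ?_, ?_⟩
    · -- `r/s` is `0` or a unit
      have two_unit : IsUnit (algebraMap ℤ B 2) :=
        IsLocalization.map_units B (⟨2, Submonoid.mem_powers 2⟩ : Submonoid.powers (2 : ℤ))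
      have one_unit : IsUnit (algebraMap ℤ B 1) := by
        rw [map_one]
        exact isUnit_one
      have neg_one_unit : IsUnit (algebraMap ℤ B (-1)) := by
        rw [map_neg]
        exact one_unit.neg
      have neg_two_unit : IsUnit (algebraMap ℤ B (-2)) := by
        rw [map_neg]
        exact two_unit.neg
      rcases hr with rfl | rfl | rfl | rfl | rfl
      · exact Or.inl (by rw [map_zero, mul_zero])
      · exact Or.inr ((Units.isUnit u⁻¹).mul one_unit)
      · exact Or.inr ((Units.isUnit u⁻¹).mul neg_one_unit)
      · exact Or.inr ((Units.isUnit u⁻¹).mul two_unit)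
      · exact Or.inr ((Units.isUnit u⁻¹).mul neg_two_unit)
    · obtain ⟨c, hc⟩ := hdvd
      refine ⟨↑u⁻¹ * algebraMap ℤ B c, ?_⟩
      rw [hX, ← _root_.mul_sub, ← map_sub, hc, map_mul]
      ring

/-- `ℤ[1/2]` is exhausted by its FINITE stages (those of `ℤ` are). [cite: Clark2015EuclideanOrderTypes, Thm. 18;
Samuel1971, Prop. 7 (p. 287)] -/
theorem IntAwayTwo.iUnion_samuelSet_natCast :
    (⋃ n : ℕ, samuelSet (Localization.Away (2 : ℤ)) n) = Set.univ :=
  IsLocalization.iUnion_samuelSet_natCast_eq_univ (Submonoid.powers (2 : ℤ)) Int.iUnion_samuelSet_natCast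

/-- `ℤ[1/2]` is exhausted by its transfinite construction. [cite: Clark2015EuclideanOrderTypes, Thm. 18] -/
theorem IntAwayTwo.forall_exists_mem_samuelSet :
    ∀ X : Localization.Away (2 : ℤ), ∃ α : Ordinal.{0}, X ∈ samuelSet (Localization.Away (2 : ℤ)) α :=
  IsLocalization.forall_exists_mem_samuelSet (Submonoid.powers (2 : ℤ)) Int.forall_exists_mem_samuelSet

/-- **`θ(5) = 2` in `ℤ[1/2]`** (a universal side divisor) … [cite: Samuel1971, §4 (4.6) (p. 289);
Clark2015EuclideanOrderTypes, Thm. 18] -/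
theorem IntAwayTwo.samuelRank_five : samuelRank (algebraMap ℤ (Localization.Away (2 : ℤ)) 5) = 2 :=
  samuelRank_eq_two_iff.2 IntAwayTwo.isUniversalSideDivisor_five

/-- … while `θ_ℤ(5) = 3`: the inequality `θ_B(a/1) ≤ θ_A(a)` of Theorem 18 can be strict.
[cite: Samuel1971, §4 Examples (1) (p. 289); Clark2015EuclideanOrderTypes, Thm. 18] -/
theorem IntAwayTwo.samuelRank_five_lt :
    samuelRank (algebraMap ℤ (Localization.Away (2 : ℤ)) 5) < samuelRank (5 : ℤ) := by
  rw [IntAwayTwo.samuelRank_five, Int.samuelRank_eq]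
  exact_mod_cast (by decide : 2 < (5 : ℤ).natAbs.size)

/-- **`e(ℤ[1/2]) = ω`**: at most `e(ℤ) = ω` by Theorem 18, at least `ω` as a Euclidean domain which is not a field (`3` is
not a unit). [cite: Clark2015EuclideanOrderTypes, Thm. 18 and §2.5 Example («`e(ℤ) = ω`»), Cor. 26] -/
theorem IntAwayTwo.iSup_samuelRank_eq_omega0 :
    (⨆ X : Localization.Away (2 : ℤ), (samuelRank X - 1 + 1)) = ω := by
  haveI : IsDomain (Localization.Away (2 : ℤ)) :=
    IsLocalization.isDomain_localization (powers_le_nonZeroDivisors_of_noZeroDivisors two_ne_zero)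
  refine le_antisymm ?_ ?_
  · rw [← Int.iSup_samuelRank_eq_omega0]
    exact IsLocalization.iSup_samuelRank_le (Submonoid.powers (2 : ℤ)) Int.forall_exists_mem_samuelSet
  · refine omega0_le_iSup_samuelRank_of_not_isUnit IntAwayTwo.forall_exists_mem_samuelSet (x := algebraMap ℤ _ 3)
      (fun h ↦ ?_) IntAwayTwo.not_isUnit_three
    exact (by norm_num : (3 : ℤ) ≠ 0) (IntAwayTwo.algebraMap_injective (by rw [h, map_zero]))

/-- `ℤ[1/2]` carries an ordinary (`ℕ`-valued) Euclidean function. [cite: Samuel1971, Prop. 7 (p. 287) and §5 Example (4)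
(p. 293)] -/
theorem IntAwayTwo.exists_euclideanFunction :
    ∃ φ : Localization.Away (2 : ℤ) → ℕ, ∀ a b : Localization.Away (2 : ℤ), b ≠ 0 →
      ∃ q s : Localization.Away (2 : ℤ), a = b * q + s ∧ (s = 0 ∨ φ s < φ b) :=
  exists_euclideanFunction_iff_iUnion_samuelSet_natCast.2 IntAwayTwo.iUnion_samuelSet_natCast

end IntAwayTwo

end Literature.Algebra.EuclideanDomain
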